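/-
Copyright (c) 2026 The HodgeCM formalization project (cell hodgecm-mathlib, squad K2·E4). Prover seat hodgecm-mathlib-K2E4-p10 (g4).
Released under Apache 2.0 license as described in the file LICENSE.
-/
import Summits.HodgeConjecture.HodgeConjecture.Theorems.K2E1IntertwiningLocalFactorIntegrableU2   -- ★ FILE B (this seat): holomorphy of `c_∞, a_v, c`, real points, residue factors; brings ★ FILE A, ★ FILE 3, ★ FILE 1
import Literature.NumberTheory.Automorphic.AdicCompletionCompact                                -- ★ `locallyCompactSpace_adicCompletion`, `locallyCompactSpace_finiteAdeleRing'`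
import HarnessLib

/-!
# K2·E1 — `K2E1SphericalConstantTermContinuationU2` («W5-B» HEAD): THE INTERTWINING SCALAR `c(z) = ν(𝓕)⁻¹·∫_{N(𝔸)} H(w₀v)^z dν` OF `U(1,1)_{L∕L⁺}` CONTINUES
# MEROMORPHICALLY TO `Re z > ½` WITH EXACTLY ONE POLE, SIMPLE, AT `z = 2ρ_H = 1`, RESIDUE `r ≠ 0` — the `c̃` input (`hc̃mer ∕ hc̃hol ∕ hc̃res` + the `c`-clause of `hE`) of ★ W5-A p858272

Track B ∕ K2-LIT, crux h413 = `stmt-HodgeConjecture-24833`, route of record `HCCMUnconditional`; cell `hodgecm-mathlib`, squad K2, ENGINE E1 (campaign «EIS-WHITTAKER-2», rung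
«W5-B», deal of K2E1-plan (g4) 2026-09-04T07:29:46Z, deck #1, taken 07:35:08Z).  Prover seat `hodgecm-mathlib-K2E4-p10` (g4).  THEOREMS ONLY (no `def`, no `instance`, no notation,
no named-fact hypothesis, no `sorry`); lane `--supports stmt-HodgeConjecture-24833 --as helper` (count-neutral).  Closes no socket.

THE MATHEMATICS [MoeglinWaldspurger1995, II.1.6–II.1.7, IV.1.11; Langlands1976, Appendix; GindikinKarpelevich1962; Garrett2018, §2.8–§2.11; Titchmarsh1939, §4.1].
ROAD = IDENTITY THEOREM.  ★ FILE 3 `inv_measure_mul_intertwiningScalar_eq_eulerProduct` gives, for REAL `σ > 1`, the Euler product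
`ν(𝓕)⁻¹·∫_{N(𝔸)} H(w₀v)^σ dν = c_∞(σ)·(∏_{v∈S} a_v(σ))·ζ^S_{L⁺}(2σ−1)∕ζ^S_{L⁺}(2σ)` (`c_∞` the normalised archimedean mean of `A^{−σ}`, `a_v` the normalised local means of
`P_v^{−σ}`, `S ⊇ S_δ` finite).  Every factor has a complex edition holomorphic on `{Re z > 1}` (★ FILE B: the moments; ★ FILE 1: the `ζ`-ratio) and the two sides agree at the
real points (★ FILE B `…_ofReal`), so they agree on `{Re z > 1}` (★ FILE A `eqOn_re_gt_of_forall_ofReal`): §1 **`intertwiningScalar_eq_eulerProduct`**.  Then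
`c̃(z) := c_∞(z)·(∏_{v∈S} a_v(z))·G(z)∕(z − 1)` with ★ FILE 1 §4's `G` (holomorphic on `{Re z > ½}`, `(z−1)·ζ^S(2z−1)∕ζ^S(2z) = G(z)` on `Re z > 1`, `G(1) ≠ 0`) is
meromorphic on `U = {Re z > ½}`, holomorphic on `U ∖ {1}`, `(z − 1)·c̃(z) → r := c_∞(1)·∏a_v(1)·G(1) ≠ 0` (★ FILE A `continuation_package_div_sub_one`, ★ FILE B
`archMean_one_ne_zero`, `localMean_one_ne_zero`), and `c̃ = c` on `Re z > 1`: §2 HEAD **`sphericalConstantTerm_continuation`** — EXACTLY the hypotheses `hc̃mer`, `hc̃hol`,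
`hc̃res` of ★ W5-A `spherical_continuation_of_inputs` at `U = {Re z > ½}` together with the `c`-clause of its `hE`, for EVERY Haar measure `ν` of `N(𝔸)` and every
fundamental domain `𝓕` of `N(L⁺)` with compact closure (the auxiliary `μ_E := volume`, `νv := addHaar`, `S := S_δ` are chosen inside).  The pole at `z = 1 = 2ρ_H` is GENUINE
(`r ≠ 0`): with ★ W5-A (c), the residue of the spherical Eisenstein series is the non-zero constant `φ₀·r` — «(H4-b)₂-sph» no longer waits on `c̃`.
HONEST LABEL: HC_CM is proved only modulo the 7 printed citations (2 remaining named inputs: hLiu418 = `stmt-HodgeConjecture-24832`, h413 = `stmt-HodgeConjecture-24833`) until rung 0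
closes; this file asserts no named fact and closes no socket; count-neutral.  CEILING NOT CLAIMED: the continuation of `c̃` to the closed half-plane `Re z ≥ ½` (R8) is not here.

## References
* [MoeglinWaldspurger1995] C. Mœglin, J.-L. Waldspurger, *Spectral Decomposition and Eisenstein Series* (1995), II.1.6–II.1.7, IV.1.11.
* [Langlands1976] R. P. Langlands, *On the Functional Equations Satisfied by Eisenstein Series*, LNM 544 (1976), Appendix.
* [GindikinKarpelevich1962] S. G. Gindikin, F. I. Karpelevič, Dokl. Akad. Nauk SSSR 145 (1962), 252–255.
* [Garrett2018] P. Garrett, *Modern Analysis of Automorphic Forms by Example* 1 (2018), §2.8–§2.11.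
* [Titchmarsh1939] E. C. Titchmarsh, *The Theory of Functions*, 2nd ed. (1939), §4.1.
-/

set_option autoImplicit false
set_option linter.dupNamespace false -- the mandated namespace repeats `HodgeConjecture.HodgeConjecture`

noncomputable section

open MeasureTheory Measure NumberField NumberField.InfinitePlace NumberField.mixedEmbedding IsDedekindDomain IsDedekindDomain.HeightOneSpectrum Set Filter Function Topology
open scoped ENNReal NNReal Classical
open Literature.NumberTheory.GaloisRepresentations.IsNonarchimedeanLocalField
open Literature.NumberTheory.Automorphic Literature.NumberTheory.Automorphic.UnitaryGroup AdelicGroupData Literature.NumberTheory.LFunctions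
open Summit.HodgeConjecture.HodgeConjecture.Cruxes.H413
open Summit.HodgeConjecture.HodgeConjecture.Cruxes.H413.K2E1PowerMomentHolomorphy
open Summit.HodgeConjecture.HodgeConjecture.Cruxes.H413.K2E1IntertwiningLocalFactorIntegrableU2
open Summit.HodgeConjecture.HodgeConjecture.Cruxes.H413.K2E1IntertwiningLocalFactorU2Line (finite_setOf_exists_extension_normAbs_ne_one)
open Summit.HodgeConjecture.HodgeConjecture.Cruxes.H413.K2E1IntertwiningScalarEulerProductU2 (inv_measure_mul_intertwiningScalar_eq_eulerProduct)
open Summit.HodgeConjecture.HodgeConjecture.Cruxes.H413.K2E1IntertwiningScalarContinuationU2 (differentiableOn_zeta_two_mul zeta_two_mul_ne_zero exists_differentiableOn_sub_one_mul_scalar)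
open Summit.HodgeConjecture.HodgeConjecture.Cruxes.H413.F0P2wPartialDedekindZetaPole (differentiableOn_partialDedekindZeta)

namespace Summit.HodgeConjecture.HodgeConjecture.Cruxes.H413.K2E1SphericalConstantTermContinuationU2

variable (L : Type) [Field L] [NumberField L] [IsCMField L]
  [MeasurableSpace (quasiSplit (↥(maximalRealSubfield L)) L (IsCMField.complexConj L) 2).Adelic] [BorelSpace (quasiSplit (↥(maximalRealSubfield L)) L (IsCMField.complexConj L) 2).Adelic]

/-! ## §1 The Euler product of the intertwining scalar, COMPLEX edition on `{Re z > 1}` -/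

/-- **THE EULER PRODUCT OF THE `U(J₂)` INTERTWINING SCALAR FOR COMPLEX `z`, `Re z > 1`**: for every Haar `ν` of `N(𝔸)`, every fundamental domain `𝓕` of `N(L⁺)` with compact closure,
every additive Haar `μ_E` on `L⁺ ⊗ ℝ`, `νv` on the `L⁺_v`, and every finset `S ⊇ S_δ`,
`ν(𝓕)⁻¹·∫_{N(𝔸)} H(w₀v)^z dν = [μ_E(D_∞)⁻¹·∫ A^{−z} dμ_E] · (∏_{v∈S} νv(𝒪_v)⁻¹·∫ P_v^{−z} dνv) · ζ^S_{L⁺}(2z−1)∕ζ^S_{L⁺}(2z)` — ★ FILE 3 at the real points, both sides holomorphic on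
`{Re z > 1}` (★ FILE B; ★ FILE 1 §2 for the `ζ`-ratio), identity theorem ★ FILE A. [cite: MoeglinWaldspurger1995, II.1.6] [cite: Langlands1976, Appendix] [cite: Titchmarsh1939, §4.1] -/
theorem intertwiningScalar_eq_eulerProduct {δ : L} (hcδ : IsCMField.complexConj L δ = -δ) (hδ : δ ≠ 0)
    [∀ v : HeightOneSpectrum (𝓞 ↥(maximalRealSubfield L)), MeasurableSpace (v.adicCompletion ↥(maximalRealSubfield L))]
    [∀ v : HeightOneSpectrum (𝓞 ↥(maximalRealSubfield L)), BorelSpace (v.adicCompletion ↥(maximalRealSubfield L))]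
    (νv : ∀ v : HeightOneSpectrum (𝓞 ↥(maximalRealSubfield L)), Measure (v.adicCompletion ↥(maximalRealSubfield L))) [∀ v, (νv v).IsAddHaarMeasure]
    (ν : Measure ↥(adelicUnipotent (↥(maximalRealSubfield L)) L (IsCMField.complexConj L) 2)) [ν.IsHaarMeasure]
    {𝓕 : Set ↥(adelicUnipotent (↥(maximalRealSubfield L)) L (IsCMField.complexConj L) 2)} (h𝓕N : IsFundamentalDomain ↥(rationalUnipotent (↥(maximalRealSubfield L)) L (IsCMField.complexConj L) 2) 𝓕 ν)
    (h𝓕c : IsCompact (closure 𝓕))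
    (μE : Measure (mixedSpace ↥(maximalRealSubfield L))) [μE.IsAddHaarMeasure]
    (S : Finset (HeightOneSpectrum (𝓞 ↥(maximalRealSubfield L)))) (hS : ∀ v ∉ S, ∀ w : v.Extension (𝓞 L), normAbs (w.1.adicCompletion L) ((algebraMap L (FiniteAdeleRing (𝓞 L) L) δ) w.1) = 1)
    {z : ℂ} (hz : 1 < z.re) :
    ((((ν 𝓕).toReal⁻¹ : ℝ)) : ℂ) * ∫ v, (((borelHeight (((quasiSplit (↥(maximalRealSubfield L)) L (IsCMField.complexConj L) 2).toAdelic (weylLongU ((IsCMField.complexConj L : L ≃ₐ[↥(maximalRealSubfield L)] L) : L →+* L) (rfl : ((StdForm.antidiagonal 2).over L) = ((StdForm.antidiagonal 2).over L)))) * (v : (quasiSplit (↥(maximalRealSubfield L)) L (IsCMField.complexConj L) 2).Adelic)) : ℝ) : ℝ) : ℂ) ^ z ∂ν = (((((μE (ZSpan.fundamentalDomain (latticeBasis ↥(maximalRealSubfield L)))).toReal⁻¹ : ℝ)) : ℂ) * ∫ s : mixedSpace ↥(maximalRealSubfield L), (((∏ w : InfinitePlace L, ((1 : ℝ) + (w δ)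 ^ 2 * (s.1 ⟨w.comap (algebraMap ↥(maximalRealSubfield L) L), K2E1HeightBigCellLineFormulaU2.isReal_comap_maximalRealSubfield L w⟩) ^ 2)) : ℝ) : ℂ) ^ (-z) ∂μE) * ((∏ v ∈ S, (((((νv v (v.adicCompletionIntegers ↥(maximalRealSubfield L))).toReal⁻¹ : ℝ)) : ℂ) * ∫ t : v.adicCompletion ↥(maximalRealSubfield L), ((((letI := Extension.fintype (𝓞 ↥(maximalRealSubfield L)) ↥(maximalRealSubfield L) L (𝓞 L) v; ∏ w : v.Extension (𝓞 L), max 1 (normAbs (w.1.adicCompletion L) (Extension.adicCompletionSemialgHom ↥(maximalRealSubfield L) L w t) * normAbs (w.1.adicCompletion L) ((algebraMap L (FiniteAdeleRing (𝓞 L) L) δ) w.1))) : ℝ≥0) : ℝ) : ℂ) ^ (-z) ∂νv v)) * (partialStandardL (↑S : Set (HeightOneSpectrum (𝓞 ↥(maximalRealSubfield L)))) (fun _ => {1}) (2 * z - 1) / partialStandardL (↑S : Set (HeightOneSpectrum (𝓞 ↥(maximalRealSubfield L)))) (fun _ => {1}) (2 * z))) := by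
  -- auxiliary structures demanded by ★ FILE 3 (not in the statement)
  letI : MeasurableSpace (FiniteAdeleRing (𝓞 ↥(maximalRealSubfield L)) ↥(maximalRealSubfield L)) := borel _
  haveI : BorelSpace (FiniteAdeleRing (𝓞 ↥(maximalRealSubfield L)) ↥(maximalRealSubfield L)) := ⟨rfl⟩
  haveI : LocallyCompactSpace (FiniteAdeleRing (𝓞 ↥(maximalRealSubfield L)) ↥(maximalRealSubfield L)) := locallyCompactSpace_finiteAdeleRing' ↥(maximalRealSubfield L)
  have hij : (((0 : Fin 2) : ℕ)) + 1 = ((1 : Fin 2) : ℕ) := rfl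
  have hN : 2 = 2 * ((0 : Fin 2) : ℕ) + 2 := rfl
  -- holomorphy of the two sides on `{Re z > 1}`
  have hsub : {w : ℂ | 1 < w.re} ⊆ {w : ℂ | 1 / 2 < w.re} := fun w hw => by
    show 1 / 2 < w.re
    have hw' : 1 < w.re := hw
    linarith
  have hζ : DifferentiableOn ℂ (fun z : ℂ => (partialStandardL (↑S : Set (HeightOneSpectrum (𝓞 ↥(maximalRealSubfield L)))) (fun _ => {1}) (2 * z - 1) / partialStandardL (↑S : Set (HeightOneSpectrum (𝓞 ↥(maximalRealSubfield L)))) (fun _ => {1}) (2 * z))) {w : ℂ | 1 < w.re} := by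
    refine (differentiableOn_partialDedekindZeta.comp ((differentiableOn_id.const_mul (2 : ℂ)).sub_const 1) fun w hw => ?_).div
      ((differentiableOn_zeta_two_mul (F := ↥(maximalRealSubfield L)) (S := (↑S : Set (HeightOneSpectrum (𝓞 ↥(maximalRealSubfield L)))))).mono hsub) fun w hw => zeta_two_mul_ne_zero (hsub hw)
    have hw' : 1 < w.re := hw
    show 1 < ((2 : ℂ) * w - 1).re
    simp only [Complex.sub_re, Complex.mul_re, Complex.one_re, Complex.re_ofNat, Complex.im_ofNat, zero_mul, sub_zero]
    linarith
  have hR : DifferentiableOn ℂ (fun z : ℂ => (((((μE (ZSpan.fundamentalDomain (latticeBasis ↥(maximalRealSubfield L)))).toReal⁻¹ : ℝ)) : ℂ) * ∫ s : mixedSpace ↥(maximalRealSubfield L), (((∏ w : InfinitePlace L, ((1 : ℝ) + (w δ) ^ 2 * (s.1 ⟨w.comap (algebraMap ↥(maximalRealSubfield L) L), K2E1HeightBigCellLineFormulaU2.isReal_comap_maximalRealSubfield L w⟩) ^ 2)) : ℝ) : ℂ) ^ (-z) ∂μE) * ((∏ v ∈ S, (((((νv v (v.adicCompletionIntegers ↥(maximalRealSubfield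 L))).toReal⁻¹ : ℝ)) : ℂ) * ∫ t : v.adicCompletion ↥(maximalRealSubfield L), ((((letI := Extension.fintype (𝓞 ↥(maximalRealSubfield L)) ↥(maximalRealSubfield L) L (𝓞 L) v; ∏ w : v.Extension (𝓞 L), max 1 (normAbs (w.1.adicCompletion L) (Extension.adicCompletionSemialgHom ↥(maximalRealSubfield L) L w t) * normAbs (w.1.adicCompletion L) ((algebraMap L (FiniteAdeleRing (𝓞 L) L) δ) w.1))) : ℝ≥0) : ℝ) : ℂ) ^ (-z) ∂νv v)) * (partialStandardL (↑S : Set (HeightOneSpectrum (𝓞 ↥(maximalRealSubfield L)))) (fun _ => {1}) (2 * z - 1) / partialStandardL (↑S : Set (HeightOneSpectrum (𝓞 ↥(maximalRealSubfield L)))) (fun _ => {1}) (2 * z)))) {w : ℂ | 1 < w.re} :=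
    ((differentiableOn_archMean L hδ μE).mono hsub).mul ((DifferentiableOn.fun_finsetProd fun v _ => (differentiableOn_localMean L hδ v (νv v)).mono hsub).mul hζ)
  refine eqOn_re_gt_of_forall_ofReal (differentiableOn_intertwiningScalar L ν h𝓕N h𝓕c) hR (fun σ hσ => ?_) hz
  -- the real points: ★ FILE 3
  show (fun z : ℂ => ((((ν 𝓕).toReal⁻¹ : ℝ)) : ℂ) * ∫ v, (((borelHeight (((quasiSplit (↥(maximalRealSubfield L)) L (IsCMField.complexConj L) 2).toAdelic (weylLongU ((IsCMField.complexConj L : L ≃ₐ[↥(maximalRealSubfield L)] L) : L →+* L) (rfl : ((StdForm.antidiagonal 2).over L) = ((StdForm.antidiagonal 2).over L)))) * (v : (quasiSplit (↥(maximalRealSubfield L)) L (IsCMField.complexConj L) 2).Adelic)) : ℝ) : ℝ) : ℂ) ^ z ∂ν) (σ : ℂ) = (fun z : ℂ => (((((μE (ZSpan.fundamentalDomain (latticeBasis ↥(maximalRealSubfield L)))).toReal⁻¹ : ℝ)) : ℂ) * ∫ s : mixedSpace ↥(maximalRealSubfield L), (((∏ w : InfinitePlace L, ((1 : ℝ) +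 (w δ) ^ 2 * (s.1 ⟨w.comap (algebraMap ↥(maximalRealSubfield L) L), K2E1HeightBigCellLineFormulaU2.isReal_comap_maximalRealSubfield L w⟩) ^ 2)) : ℝ) : ℂ) ^ (-z) ∂μE) * ((∏ v ∈ S, (((((νv v (v.adicCompletionIntegers ↥(maximalRealSubfield L))).toReal⁻¹ : ℝ)) : ℂ) * ∫ t : v.adicCompletion ↥(maximalRealSubfield L), ((((letI := Extension.fintype (𝓞 ↥(maximalRealSubfield L)) ↥(maximalRealSubfield L) L (𝓞 L) v; ∏ w : v.Extension (𝓞 L), max 1 (normAbs (w.1.adicCompletion L) (Extension.adicCompletionSemialgHom ↥(maximalRealSubfield L) L w t) * normAbs (w.1.adicCompletion L) ((algebraMap L (FiniteAdeleRing (𝓞 L) L) δ) w.1))) : ℝ≥0) : ℝ) : ℂ) ^ (-z) ∂νv v)) * (partialStandardL (↑S : Set (HeightOneSpectrum (𝓞 ↥(maximalRealSubfield L)))) (fun _ => {1}) (2 * z - 1) / partialStandardL (↑S : Set (HeightOneSpectrum (𝓞 ↥(maximalRealSubfield L)))) (fun _ => {1}) (2 * z)))) (σ : ℂ)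
  simp only
  rw [intertwiningScalar_ofReal, archMean_ofReal, Finset.prod_congr rfl fun v _ => localMean_ofReal L v (νv v) σ]
  exact inv_measure_mul_intertwiningScalar_eq_eulerProduct L hij hN hcδ hδ νv hσ ν h𝓕N μE (Measure.addHaar) S hS

/-! ## §2 THE HEAD: the meromorphic continuation of `c` to `Re z > ½` with its single simple pole at `z = 1` -/

/-- **W5-B — MEROMORPHIC CONTINUATION OF THE SPHERICAL CONSTANT-TERM SCALAR OF `U(1,1)_{L∕L⁺}`.**  For every Haar measure `ν` of `N(𝔸)` and every fundamental domain `𝓕` of `N(L⁺)` with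
compact closure there are `c̃ : ℂ → ℂ` and `r ≠ 0` with: `c̃` meromorphic on `U = {Re z > ½}`, holomorphic on `U ∖ {1}`, `(z − 1)·c̃(z) → r` as `z → 1` (`z ≠ 1`), and
`c̃(z) = ν(𝓕)⁻¹·∫_{N(𝔸)} H(w₀v)^z dν` for `Re z > 1` — literally the hypotheses `hc̃mer`, `hc̃hol`, `hc̃res` of ★ W5-A `spherical_continuation_of_inputs` and the `c`-clause of its `hE`.
(`c̃ = c_∞·∏_{v∈S_δ}a_v·G∕(z−1)`, `r = c_∞(1)·∏a_v(1)·G(1)`; §1, ★ FILE 1 §4, ★ FILE A §4, ★ FILE B §3.)  The pole at `z = 2ρ_H = 1` is genuine and is the only one on `Re z > ½`.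
[cite: MoeglinWaldspurger1995, IV.1.11] [cite: Langlands1976, Appendix] [cite: Garrett2018, §2.8–§2.11] -/
theorem sphericalConstantTerm_continuation {δ : L} (hcδ : IsCMField.complexConj L δ = -δ) (hδ : δ ≠ 0)
    (ν : Measure ↥(adelicUnipotent (↥(maximalRealSubfield L)) L (IsCMField.complexConj L) 2)) [ν.IsHaarMeasure]
    {𝓕 : Set ↥(adelicUnipotent (↥(maximalRealSubfield L)) L (IsCMField.complexConj L) 2)} (h𝓕N : IsFundamentalDomain ↥(rationalUnipotent (↥(maximalRealSubfield L)) L (IsCMField.complexConj L) 2) 𝓕 ν)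
    (h𝓕c : IsCompact (closure 𝓕)) :
    ∃ c : ℂ → ℂ, ∃ r : ℂ, r ≠ 0 ∧ MeromorphicOn c {z : ℂ | 1 / 2 < z.re} ∧ DifferentiableOn ℂ c ({z : ℂ | 1 / 2 < z.re} \ {1}) ∧
      Tendsto (fun z : ℂ => (z - 1) * c z) (𝓝[≠] 1) (𝓝 r) ∧
      ∀ z : ℂ, 1 < z.re → c z = ((((ν 𝓕).toReal⁻¹ : ℝ)) : ℂ) * ∫ v, (((borelHeight (((quasiSplit (↥(maximalRealSubfield L)) L (IsCMField.complexConj L) 2).toAdelic (weylLongU ((IsCMField.complexConj L : L ≃ₐ[↥(maximalRealSubfield L)] L) : L →+* L) (rfl : ((StdForm.antidiagonal 2).over L) = ((StdForm.antidiagonal 2).over L)))) * (v : (quasiSplit (↥(maximalRealSubfield L)) L (IsCMField.complexConj L) 2).Adelic)) : ℝ) : ℝ) : ℂ) ^ z ∂ν := by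
  -- choices (not in the statement): Borel structures and Haar measures at the finite places of `L⁺`, `volume` at infinity, `S := S_δ`
  letI : ∀ v : HeightOneSpectrum (𝓞 ↥(maximalRealSubfield L)), MeasurableSpace (v.adicCompletion ↥(maximalRealSubfield L)) := fun v => borel _
  haveI : ∀ v : HeightOneSpectrum (𝓞 ↥(maximalRealSubfield L)), BorelSpace (v.adicCompletion ↥(maximalRealSubfield L)) := fun v => ⟨rfl⟩
  haveI : ∀ v : HeightOneSpectrum (𝓞 ↥(maximalRealSubfield L)), LocallyCompactSpace (v.adicCompletion ↥(maximalRealSubfield L)) :=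
    fun v => locallyCompactSpace_adicCompletion ↥(maximalRealSubfield L) v
  set νv : ∀ v : HeightOneSpectrum (𝓞 ↥(maximalRealSubfield L)), Measure (v.adicCompletion ↥(maximalRealSubfield L)) := fun v => Measure.addHaar with hνv
  set μE : Measure (mixedSpace ↥(maximalRealSubfield L)) := volume with hμE
  set S : Finset (HeightOneSpectrum (𝓞 ↥(maximalRealSubfield L))) := (finite_setOf_exists_extension_normAbs_ne_one (F := ↥(maximalRealSubfield L)) (E := L) hδ).toFinset with hSdef
  have hS : ∀ v ∉ S, ∀ w : v.Extension (𝓞 L), normAbs (w.1.adicCompletion L) ((algebraMap L (FiniteAdeleRing (𝓞 L) L) δ) w.1) = 1 := by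
    intro v hv w
    by_contra h
    exact hv ((Set.Finite.mem_toFinset _).2 ⟨w, h⟩)
  -- the `ζ`-part (★ FILE 1 §4) and the holomorphic factor `B = c_∞·∏ a_v` (★ FILE B)
  obtain ⟨G, hG, hGeq, hG1⟩ := exists_differentiableOn_sub_one_mul_scalar (F := ↥(maximalRealSubfield L)) (S := (↑S : Set (HeightOneSpectrum (𝓞 ↥(maximalRealSubfield L))))) S.finite_toSet
  have hUo : IsOpen {z : ℂ | 1 / 2 < z.re} := isOpen_lt continuous_const Complex.continuous_re
  have h1U : (1 : ℂ) ∈ {z : ℂ | 1 / 2 < z.re} := by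
    show (1 : ℝ) / 2 < (1 : ℂ).re
    norm_num
  set B : ℂ → ℂ := fun z => (((((μE (ZSpan.fundamentalDomain (latticeBasis ↥(maximalRealSubfield L)))).toReal⁻¹ : ℝ)) : ℂ) * ∫ s : mixedSpace ↥(maximalRealSubfield L), (((∏ w : InfinitePlace L, ((1 : ℝ) + (w δ) ^ 2 * (s.1 ⟨w.comap (algebraMap ↥(maximalRealSubfield L) L), K2E1HeightBigCellLineFormulaU2.isReal_comap_maximalRealSubfield L w⟩) ^ 2)) : ℝ) : ℂ) ^ (-z) ∂μE) * ∏ v ∈ S, (((((νv v (v.adicCompletionIntegers ↥(maximalRealSubfield L))).toReal⁻¹ : ℝ)) : ℂ) * ∫ t : v.adicCompletion ↥(maximalRealSubfield L), ((((letI := Extension.fintype (𝓞 ↥(maximalRealSubfield L)) ↥(maximalRealSubfield L) L (𝓞 L) v; ∏ w : v.Extension (𝓞 L), max 1 (normAbs (w.1.adicCompletion L) (Extension.adicCompletionSemialgHom ↥(maximalRealSubfield L) L w t) * normAbs (w.1.adicCompletion L) ((algebraMap L (FiniteAdeleRing (𝓞 L) L) δ) w.1))) : ℝ≥0) : ℝ)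 : ℂ) ^ (-z) ∂νv v) with hB
  have hBhol : DifferentiableOn ℂ B {z : ℂ | 1 / 2 < z.re} :=
    (differentiableOn_archMean L hδ μE).mul (DifferentiableOn.fun_finsetProd fun v _ => differentiableOn_localMean L hδ v (νv v))
  have hB1 : B 1 ≠ 0 :=
    mul_ne_zero (archMean_one_ne_zero L hδ μE) (Finset.prod_ne_zero_iff.2 fun v _ => localMean_one_ne_zero L hδ v (νv v))
  set F : ℂ → ℂ := fun z => B z * G z with hF
  have hFhol : DifferentiableOn ℂ F {z : ℂ | 1 / 2 < z.re} := hBhol.mul hG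
  obtain ⟨hmer, hhol, hres⟩ := continuation_package_div_sub_one hUo h1U hFhol
  refine ⟨fun z => F z / (z - 1), F 1, mul_ne_zero hB1 hG1, hmer, hhol, hres, fun z hz => ?_⟩
  -- on `Re z > 1`: `F(z)∕(z−1) = B(z)·ζ^S(2z−1)∕ζ^S(2z) = c(z)` (§1)
  have hz1 : (z : ℂ) - 1 ≠ 0 := by
    intro h
    have h' := congrArg Complex.re h
    simp only [Complex.sub_re, Complex.one_re, Complex.zero_re] at h'
    linarith
  rw [intertwiningScalar_eq_eulerProduct L hcδ hδ νv ν h𝓕N h𝓕c μE S hS hz]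
  show B z * G z / (z - 1) = (((((μE (ZSpan.fundamentalDomain (latticeBasis ↥(maximalRealSubfield L)))).toReal⁻¹ : ℝ)) : ℂ) * ∫ s : mixedSpace ↥(maximalRealSubfield L), (((∏ w : InfinitePlace L, ((1 : ℝ) + (w δ) ^ 2 * (s.1 ⟨w.comap (algebraMap ↥(maximalRealSubfield L) L), K2E1HeightBigCellLineFormulaU2.isReal_comap_maximalRealSubfield L w⟩) ^ 2)) : ℝ) : ℂ) ^ (-z) ∂μE) * ((∏ v ∈ S, (((((νv v (v.adicCompletionIntegers ↥(maximalRealSubfield L))).toReal⁻¹ : ℝ)) : ℂ) * ∫ t : v.adicCompletion ↥(maximalRealSubfield L), ((((letI := Extension.fintype (𝓞 ↥(maximalRealSubfield L)) ↥(maximalRealSubfield L) L (𝓞 L) v; ∏ w : v.Extension (𝓞 L), max 1 (normAbs (w.1.adicCompletion L) (Extension.adicCompletionSemialgHom ↥(maximalRealSubfield L) L w t) * normAbs (w.1.adicCompletion L) ((algebraMap L (FiniteAdeleRing (𝓞 L) L) δ) w.1))) : ℝ≥0) : ℝ) : ℂ) ^ (-z) ∂νv v)) * (partialStandardL (↑S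 : Set (HeightOneSpectrum (𝓞 ↥(maximalRealSubfield L)))) (fun _ => {1}) (2 * z - 1) / partialStandardL (↑S : Set (HeightOneSpectrum (𝓞 ↥(maximalRealSubfield L)))) (fun _ => {1}) (2 * z)))
  rw [← hGeq z hz, hB]
  field_simp

end Summit.HodgeConjecture.HodgeConjecture.Cruxes.H413.K2E1SphericalConstantTermContinuationU2

end
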